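import Summits.BirchSwinnertonDyer.BirchSwinnertonDyer.Theorems.EisensteinPrimesMazurMCOnCellBTwistbackSubrowPartnerGivenBernoulli
import Summits.BirchSwinnertonDyer.BirchSwinnertonDyer.Theorems.EisensteinPrimesMazurMCOnCellBTwistbackFieldSupplyDefs
import HarnessLib

/-!
# Crux 3 `MazurMCOnCellB` (stmt-BirchSwinnertonDyer-19033), line `twistback` v5 — stub 6′ (∃-PARTNER) AT `(W, p)`,
# sub-population (iii), from the typed FIELD SUPPLY: `HeegnerFieldWithBernoulliUnit` ⟹ the `K`-given Bernoulli doors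

Width seat bsd-line-x2-p1-w5 g2 (2026-08-28). HONEST FRAMING (cell `bsd-eis`, run/shared/lean/pub/bsd-eis/): bookkeeping
THEOREMS ONLY (no `def`, no named fact introduced, no `sorry`); `--supports` stmt-BirchSwinnertonDyer-19033; closes no
registered stub; no summit statement, no Mazur main conjecture and no BSD is proved for any curve; every theorem is
conditional on the named facts exactly as labelled (PublishedInputs, Disegni 2020 Thm. 4(1), Greenberg–Vatsal Thm. (3.11),
Dokchitser–Dokchitser 2010 Thm. 1.4 — PUBLISHED; Keller–Yin Thm. E — PREPRINT) AND on the supply predicate; 0 cells /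
labels / tiers move.

WHY. LEAD g12's doors (p659820) give stub 6′'s conclusion at a non-split X2b pair `(W, p)`, ANY odd `p`, ANY line
characters, once an admissible field `K` with a Bernoulli unit is GIVEN. The predicate
`EisensteinPrimesMazurMCOnCellBTwistbackFieldSupplyDefs.HeegnerFieldWithBernoulliUnit p N N₀ n n' χ` (companion Defs file)
packages exactly the `K`-dependent hypotheses of those doors. This file is the two-line composition, so that a later
skeleton can carry the supply as ONE registered stub of analytic number theory (or a kit certificate per datum) and
reach 6′ on sub-population (iii) through the tree:
* §1 `upperPartner_at_of_ramifiedOdd_of_supply_of_thmE` — FIRST X2b shape (line of `E` ramified-odd; `p ∣ m`, `p ∤ d`),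
  supply at `(n, χ, n') = (d, ψ, m)`.
* §2 `upperPartner_at_of_unramifiedEven_of_supply_of_thmE` — SECOND shape (`p ∤ m`, `p ∣ d`), supply at `(m, φ, d)`.
Both `_of_thmE` (the twist's analytic rank derived through Keller–Yin Thm. E, as on the closed sub-row); the PUB-only
doors of p659820 need `r_an(E^K) = 1` for the supplied `K` and are not packaged here.

References: [GreenbergVatsal2000] Thm. (1.3), §2 p. 28, §3 (26)–(28), Thm. (3.11); [Disegni2020] Thm. 4 (§3.2);
[DokchitserDokchitserAnnals2010] Thm. 1.4; [Wuthrich2014] Thm. 16; [KellerYin2024] Thm. E (PRE); [NakagawaHorie1988] Thm. 1.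
-/

set_option autoImplicit false

-- `Summit.BirchSwinnertonDyer.BirchSwinnertonDyer.…`: the summit and its single sub-problem share a name.
set_option linter.dupNamespace false

noncomputable section

open scoped Classical MatrixGroups ModularForm NumberTheorySymbols

open CongruenceSubgroup WeierstrassCurve NumberField IsDedekindDomain Field DirichletCharacter Rat.HeightOneSpectrum
  Literature.NumberTheory.EllipticCurves Literature.NumberTheory.GaloisRepresentations
  Literature.NumberTheory.EllipticCurves.ModularForms Literature.NumberTheory.QuadraticFields
  Literature.NumberTheory.EllipticCurves.Rank1Residual Literature.NumberTheory.EllipticCurves.Rank1Residual.Typed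
  Literature.NumberTheory.EllipticCurves.Wuthrich2014 Literature.NumberTheory.EllipticCurves.GreenbergVatsal2000
  Literature.NumberTheory.EllipticCurves.Disegni2020 Literature.NumberTheory.EllipticCurves.KellerYin2024
  Summit.BirchSwinnertonDyer.Rank1Residual Summit.BirchSwinnertonDyer.Rank1Residual.X2
  Summit.BirchSwinnertonDyer.BirchSwinnertonDyer.Theses
  Summit.BirchSwinnertonDyer.BirchSwinnertonDyer.Theorems.EisensteinPrimesMazurMCOnCellBTwistbackTwistLineCharacters
  Summit.BirchSwinnertonDyer.BirchSwinnertonDyer.Theorems.EisensteinPrimesMazurMCOnCellBTwistbackTwistLocalBalance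
  Summit.BirchSwinnertonDyer.BirchSwinnertonDyer.Theorems.EisensteinPrimesMazurMCOnCellBTwistbackSubrowPartnerGivenBernoulli
  Summit.BirchSwinnertonDyer.BirchSwinnertonDyer.Theorems.EisensteinPrimesMazurMCOnCellBTwistbackFieldSupplyDefs

namespace Summit.BirchSwinnertonDyer.BirchSwinnertonDyer.Theorems.EisensteinPrimesMazurMCOnCellBTwistbackSubrowPartnerOfSupply

section Supply

variable (W : WeierstrassCurve ℚ) [W.IsElliptic] [W.IsGloballyMinimal] (p : ℕ) [Fact p.Prime]

/-! ## §1. FIRST shape (line of `E` ramified-odd), supply at `(d, ψ, m)` -/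

/-- **Stub 6′ (∃-PARTNER) AT a non-split X2b pair `(W, p)`, FIRST shape, from the typed field SUPPLY**: the pair data
(rational `p`-line `Φ₀` ramified-odd with primitive characters `φ` mod `m`, `ψ` mod `d`, `p ∣ m`, `p ∤ d`; a finite set
`S₀ ∌ (p)` of places off which `W` is good away from `p`, with the balance-one identity `hbal`; a level `N₀` divisible by
the `S₀`-primes) plus `HeegnerFieldWithBernoulliUnit p N_W N₀ d m ψ` give the conclusion of `stub_upperPartnerOffSubrow`
at `(W, p)`: unpack the supplied `K` and apply p659820's
`upperPartner_at_of_ramifiedOdd_of_bernoulliUnit_of_thmE`. Conditional on the named facts as labelled (Keller–Yin Thm. E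
PRE) and on the supply. [claim: KellerYin2024, status: under-review] [cite: GreenbergVatsal2000, §3 Thm. (3.11) and §2 p. 28]
[cite: DokchitserDokchitserAnnals2010, Thm. 1.4] [cite: Disegni2020, Thm. 4 (§3.2)] [cite: Wuthrich2014, Thm. 16 (p. 397)] -/
theorem upperPartner_at_of_ramifiedOdd_of_supply_of_thmE (hP : EisensteinPrimes.PublishedInputs)
    (hDis : padicBSD_rankOne_nonsplitMult) (h311 : thm311_hasUnitContent_iff_and_order_eq_of_lineRamifiedEven)
    (hDD : ∀ (V : WeierstrassCurve ℚ) [V.IsElliptic] (ℓ : ℕ) [Fact ℓ.Prime], selmerCorank_mod_two_eq V ℓ)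
    (hKY : thmE_pConverse_semistable_OPEN)
    (hc : X2.CellB W p) (hns : ¬ W.HasSplitMultiplicativeReductionAtPrime p)
    {Φ₀ : AddSubgroup (geomTorsion W (p : ℤ))} (hΦ : IsRationalLine W p Φ₀)
    (hram : ¬ LineUnramifiedAt W p Φ₀) (hodd : LineOdd W p Φ₀)
    {m : ℕ} [NeZero m] (φ : DirichletCharacter (ZMod p) m) {d : ℕ} [NeZero d]
    (ψ : DirichletCharacter (ZMod p) d) (hφ : φ.IsPrimitive) (hψ : ψ.IsPrimitive) (hpm : p ∣ m)
    (hpd : ¬ p ∣ d)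
    (hφ0 : ∀ (σ : absoluteGaloisGroup ℚ), ∀ P ∈ Φ₀,
      σ • P = (φ ((modNCyclotomicCharacter ℚ m σ : (ZMod m)ˣ) : ZMod m)).val • P)
    (hψ0 : ∀ (σ : absoluteGaloisGroup ℚ) (P : geomTorsion W (p : ℤ)),
      σ • P - (ψ ((modNCyclotomicCharacter ℚ d σ : (ZMod d)ˣ) : ZMod d)).val • P ∈ Φ₀)
    (S₀ : Finset (HeightOneSpectrum (𝓞 ℚ))) (hS₀p : ∀ v ∈ S₀, ((p : ℕ) : 𝓞 ℚ) ∉ v.asIdeal)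
    (hS : ∀ v : HeightOneSpectrum (𝓞 ℚ), v ∉ S₀ → ((p : ℕ) : 𝓞 ℚ) ∉ v.asIdeal → W.HasGoodReductionAt v)
    (hbal : 1 + ∑ v ∈ S₀, delta W p v =
      ∑ v ∈ S₀, ((if φ (Rat.HeightOneSpectrum.natGenerator v : ZMod m) =
            (Rat.HeightOneSpectrum.natGenerator v : ZMod p)
          then sFactor p (Rat.HeightOneSpectrum.natGenerator v) else 0) +
        (if ψ (Rat.HeightOneSpectrum.natGenerator v : ZMod d) =
            (Rat.HeightOneSpectrum.natGenerator v : ZMod p)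
          then sFactor p (Rat.HeightOneSpectrum.natGenerator v) else 0)))
    {N₀ : ℕ} (hS₀N₀ : ∀ v ∈ S₀, Rat.HeightOneSpectrum.natGenerator v ∣ N₀)
    (hSup : HeegnerFieldWithBernoulliUnit p (W.conductorNorm ℤ) N₀ d m ψ) :
    ∃ (K : Type) (_ : Field K) (_ : NumberField K), IsImaginaryQuadratic K ∧
      SatisfiesHeegnerHypothesis (W.conductorNorm ℤ) K ∧ SatisfiesHeegnerHypothesis p K ∧
      Odd (NumberField.discr K) ∧ NumberField.discr K < -4 ∧
      (W.quadraticTwist (NumberField.discr K : ℚ)).analyticRank = 1 ∧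
      ∀ (Wd : WeierstrassCurve ℚ) [Wd.IsElliptic] [Wd.IsGloballyMinimal],
        (∃ C : VariableChange ℚ, C • Wd = W.quadraticTwist (NumberField.discr K : ℚ)) →
        MissingUpperBoundAt Wd p := by
  obtain ⟨K, _, _, hK, hHN, hHp, hHN₀, hoddK, hlt, hdK, hmK, hB⟩ := hSup
  exact EisensteinPrimesMazurMCOnCellBTwistbackSubrowPartnerGivenBernoulli.upperPartner_at_of_ramifiedOdd_of_bernoulliUnit_of_thmE
    W p hP hDis h311 hDD hKY hc hns hΦ hram hodd φ ψ hφ hψ hpm hpd hφ0 hψ0 S₀ hS₀p hS hbal K hK hHN hHp hoddK hlt hHN₀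
    hS₀N₀ hmK hdK hB

/-! ## §2. SECOND shape (line of `E` unramified-even), supply at `(m, φ, d)` -/

/-- **Stub 6′ (∃-PARTNER) AT a non-split X2b pair `(W, p)`, SECOND shape, from the typed field SUPPLY** (`p ∤ m`,
`p ∣ d`; supply `HeegnerFieldWithBernoulliUnit p N_W N₀ m d φ`; p659820's
`upperPartner_at_of_unramifiedEven_of_bernoulliUnit_of_thmE`). Conditional as in §1.
[claim: KellerYin2024, status: under-review] [cite: GreenbergVatsal2000, §3 Thm. (3.11) and §2 p. 28]
[cite: DokchitserDokchitserAnnals2010, Thm. 1.4] [cite: Disegni2020, Thm. 4 (§3.2)] [cite: Wuthrich2014, Thm. 16 (p. 397)] -/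
theorem upperPartner_at_of_unramifiedEven_of_supply_of_thmE (hP : EisensteinPrimes.PublishedInputs)
    (hDis : padicBSD_rankOne_nonsplitMult) (h311 : thm311_hasUnitContent_iff_and_order_eq_of_lineRamifiedEven)
    (hDD : ∀ (V : WeierstrassCurve ℚ) [V.IsElliptic] (ℓ : ℕ) [Fact ℓ.Prime], selmerCorank_mod_two_eq V ℓ)
    (hKY : thmE_pConverse_semistable_OPEN)
    (hc : X2.CellB W p) (hns : ¬ W.HasSplitMultiplicativeReductionAtPrime p)
    {Φ₀ : AddSubgroup (geomTorsion W (p : ℤ))} (hΦ : IsRationalLine W p Φ₀)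
    (hunr : LineUnramifiedAt W p Φ₀) (heven : LineEven W p Φ₀)
    {m : ℕ} [NeZero m] (φ : DirichletCharacter (ZMod p) m) {d : ℕ} [NeZero d]
    (ψ : DirichletCharacter (ZMod p) d) (hφ : φ.IsPrimitive) (hψ : ψ.IsPrimitive) (hpm : ¬ p ∣ m)
    (hpd : p ∣ d)
    (hφ0 : ∀ (σ : absoluteGaloisGroup ℚ), ∀ P ∈ Φ₀,
      σ • P = (φ ((modNCyclotomicCharacter ℚ m σ : (ZMod m)ˣ) : ZMod m)).val • P)
    (hψ0 : ∀ (σ : absoluteGaloisGroup ℚ) (P : geomTorsion W (p : ℤ)),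
      σ • P - (ψ ((modNCyclotomicCharacter ℚ d σ : (ZMod d)ˣ) : ZMod d)).val • P ∈ Φ₀)
    (S₀ : Finset (HeightOneSpectrum (𝓞 ℚ))) (hS₀p : ∀ v ∈ S₀, ((p : ℕ) : 𝓞 ℚ) ∉ v.asIdeal)
    (hS : ∀ v : HeightOneSpectrum (𝓞 ℚ), v ∉ S₀ → ((p : ℕ) : 𝓞 ℚ) ∉ v.asIdeal → W.HasGoodReductionAt v)
    (hbal : 1 + ∑ v ∈ S₀, delta W p v =
      ∑ v ∈ S₀, ((if φ (Rat.HeightOneSpectrum.natGenerator v : ZMod m) =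
            (Rat.HeightOneSpectrum.natGenerator v : ZMod p)
          then sFactor p (Rat.HeightOneSpectrum.natGenerator v) else 0) +
        (if ψ (Rat.HeightOneSpectrum.natGenerator v : ZMod d) =
            (Rat.HeightOneSpectrum.natGenerator v : ZMod p)
          then sFactor p (Rat.HeightOneSpectrum.natGenerator v) else 0)))
    {N₀ : ℕ} (hS₀N₀ : ∀ v ∈ S₀, Rat.HeightOneSpectrum.natGenerator v ∣ N₀)
    (hSup : HeegnerFieldWithBernoulliUnit p (W.conductorNorm ℤ) N₀ m d φ) :
    ∃ (K : Type) (_ : Field K) (_ : NumberField K), IsImaginaryQuadratic K ∧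
      SatisfiesHeegnerHypothesis (W.conductorNorm ℤ) K ∧ SatisfiesHeegnerHypothesis p K ∧
      Odd (NumberField.discr K) ∧ NumberField.discr K < -4 ∧
      (W.quadraticTwist (NumberField.discr K : ℚ)).analyticRank = 1 ∧
      ∀ (Wd : WeierstrassCurve ℚ) [Wd.IsElliptic] [Wd.IsGloballyMinimal],
        (∃ C : VariableChange ℚ, C • Wd = W.quadraticTwist (NumberField.discr K : ℚ)) →
        MissingUpperBoundAt Wd p := by
  obtain ⟨K, _, _, hK, hHN, hHp, hHN₀, hoddK, hlt, hmK, hdK, hB⟩ := hSup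
  exact EisensteinPrimesMazurMCOnCellBTwistbackSubrowPartnerGivenBernoulli.upperPartner_at_of_unramifiedEven_of_bernoulliUnit_of_thmE
    W p hP hDis h311 hDD hKY hc hns hΦ hunr heven φ ψ hφ hψ hpm hpd hφ0 hψ0 S₀ hS₀p hS hbal K hK hHN hHp hoddK hlt hHN₀
    hS₀N₀ hmK hdK hB

end Supply

end Summit.BirchSwinnertonDyer.BirchSwinnertonDyer.Theorems.EisensteinPrimesMazurMCOnCellBTwistbackSubrowPartnerOfSupply

end
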